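import Summits.BirchSwinnertonDyer.BirchSwinnertonDyer.Theorems.ByReductionTypeAtTwoAdditivePotMultConjATwoOddPowerCertificate
import Summits.BirchSwinnertonDyer.BirchSwinnertonDyer.Theorems.ByReductionTypeAtTwoFineSelmerConjAAtTwoAdditivePotGoodAscentStampsA
import HarnessLib

/-!
# C4″ `AdditivePotMultOverKAtTwo` (item stmt-BirchSwinnertonDyer-22618), the (I1M′) input of the upper half on the `0 < Δ` rows:
# NARROW STAMPS, part C / CLASS — the totally real cubic `2`-torsion field of discriminant `215832` (`X³ + (-1)X² + (-38)X + (-6)`): irreducibility and ODD CLASS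
# NUMBER by a norm certificate below the Minkowski bound (KERNEL; GEN 11's generator; rows 431664dk1)

Cell `bsd-2adic`, rung K4, seat `bsd-2adic-k4-w3` GEN 12 (explicit unit of director-bsd g16 (309)(7); `--supports stmt-BirchSwinnertonDyer-22618`).
HONEST FRAMING (D-0036/D-0054/D-0152): THEOREMS ONLY (no definition, no named fact, no `sorry`, no instance). The five files `…NarrowStampsC{{Class,Field,Units,Layer,Rows}}`
carry k4-w1's zero-hypothesis narrow-Fukuda road (`conjA_two_445508b1''`) for ONE totally real cubic field `ℚ(θ)` (eng-2's reduced cubic of the rows'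
`2`-division field, or an odd-index generator of it) through the GEN 12 kit (`…NarrowRoadKit{{,Squares,Doors,Real}}`): FIELD = `irreducible_cubic_d215832p`,
`odd_classNumber_of_root_d215832p` (norm certificate below the Minkowski bound, GEN 11's generator), `exists_three_ringHom_adjoin_d215832p` / `isTotallyReal_adjoin_d215832p`,
`unitCertificate_adjoin_d215832p` / `card_totPosUnitsModSq_adjoin_d215832p` (`#(U⁺/U²) = 2`: a mixed-sign unit and a totally positive unit that is a quadratic non-residue
modulo a principal prime), `layerOneBit_d215832p` (`2 ∤ h(ℚ(θ,√2))`: Chevalley's door at `2` with a `2`-adic non-norm unit, k4-w1 `layerOneBit_of_chevalleyCert`),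
`totallyRamifiedFrom_zero_adjoin_d215832p` (even-index certificate); LAYER = `card_totPosUnitsModSq_sup_layer_one_d215832p` (five units of `ℚ(θ,√2)`, algebraic integers by
their monic sextics: UNITS file `layerUnits_d215832p`, with an invertible `5 × 5` sign matrix at five real embeddings, every entry by rational interval arithmetic on the located roots) and
**`narrowIndex_eq_d215832p`** (both narrow indices `= 2`); ROWS = `conjA_two_<L>'`, Coates–Sujatha's statement (A) at `p = 2` for the census cubic model of each
Cremona class, PROVED OUTRIGHT by the kit's door `conjA_two_cubicModel_of_narrowRoad` (cruxlead-19573-w2's NARROW FUKUDA + Kida-lite + kernel Lim 3.5@2).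
All certificates were found by the seat's exact-arithmetic tools (`tools/narrowcert.py`: k4-w2 GEN 12's unit lattice search `nf6/units`, GEN 11's `index3/cubiccert5`
for the `2`-adic and class-number data, `fieldiso`) and are CHECKED HERE by the kernel; eng-2's certified numerics (CERT-ADD-POTMULT-POS81-AB-E2: `(a) ORDER cert ∧
(b) NARROW-EQUAL01 cert`, `h⁺ = 2h` at layers `0, 1`) agree. These are the FIRST kernel (A)₂ rows on the `Δ > 0` half of (I1M′). Statement (A) is NOT BSD:
BSD₂ for these curves is not proved; C4″ / (I1M′) stay research-open; nothing booked; no row of 22618 changes tier (pen RC-490 (4)); BSD is not proved by any of this.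

References: [CoatesSujatha2005] Conj. A, Thm. 3.4; [Fukuda1994] Thm. 1 (2); [FrohlichTaylor1990] Ch. V §1 (1.8)–(1.13); [Lang1990] Ch. 13 §4 Lemma 4.1;
[Washington1997] §13.1, Prop. 13.2; [Cohen1993] §4.1.3, §6.3; [Marcus1977] Ch. 5 Thm. 22, 35–37; cell file `eng2/fukuda269/pos81/TABLE-ADD-POTMULT-POS81-AB-E2-v1.tsv`.
-/

set_option autoImplicit false
-- sibling precedent (`…NarrowRankStamp445508b1.lean`): the directory name repeats the summit name
set_option linter.dupNamespace false

noncomputable section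
open scoped Classical IntermediateField NumberField Real nonZeroDivisors
namespace Summit.BirchSwinnertonDyer.BirchSwinnertonDyer.Theorems.AddKatoTwo
open WeierstrassCurve Field Polynomial IsDedekindDomain NumberField Matrix Literature.NumberTheory.EllipticCurves
  Literature.NumberTheory.GaloisRepresentations
  Literature.NumberTheory.IwasawaTheory
  Summit.BirchSwinnertonDyer.BirchSwinnertonDyer.Theorems.SteinbergFibreAtTwo
  Summit.BirchSwinnertonDyer.BirchSwinnertonDyer.Theorems.AlignedTransportAtTwoTorsionPointField

/-! ## The cubic field of discriminant `215832` (`X³ + (-1)X² + (-38)X + (-6)`, index `1`, `h = 1`; C4″ rows 431664dk1) -/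

/-- `X³ + (-1)X² + (-38)X + (-6)` is irreducible over `ℚ` (no root mod `7`). -/
theorem irreducible_cubic_d215832p : Irreducible (Cubic.toPoly ⟨1, ((-1 : ℤ) : ℚ), ((-38 : ℤ) : ℚ), ((-6 : ℤ) : ℚ)⟩) :=
  haveI : Fact (Nat.Prime 7) := ⟨by norm_num⟩
  irreducible_cubic_of_no_root_zmod 7 (by decide)

section Certd215832p

variable (K : Type) [Field K] [NumberField K]

/-- **`h` is ODD for every cubic number field whose integers contain a root `θ` of `X³ + (-1)X² + (-38)X + (-6)`** (`|disc| = 215832 = 1²·215832`,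
`|d_K| ≤ 215832`, `M_K < 132`): a norm certificate — for every prime `ℓ < 132` and every root `a` of the cubic mod `ℓ` a generator
`(x + yθ + zθ²)/m ∈ 𝓞 K` of the ideal `I ∋ ℓ, θ − a` of norm `ℓ`, or of its CUBE with Bézout data (33 witnesses; 0 cube witnesses; 0 with `m > 1` outside `ℤ[θ]`; the prime(s) dividing the index `1` through the
second generator `θ₀` of `𝓞 K` (`exists_intElem_of_scaled_cubic`), 0 witnesses). Found by the seat's relation sieve (Hermite normal form over the `S`-unit lattice) and
CHECKED HERE by the kernel (`pow_three_eq_span_of_cert`). eng-2's PARI value (bnfcertify): `h = 1`. KERNEL. [cite: Marcus1977, Ch. 5 Thm. 35–37 and Cor. 2] [cite: Cohen1993, §6.3] -/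
theorem odd_classNumber_of_root_d215832p (h3 : Module.finrank ℚ K = 3) (b : 𝓞 K)
    (hb : b ^ 3 + (-1 : ℤ) * b ^ 2 + (-38 : ℤ) * b + (-6 : ℤ) = 0) : Odd (NumberField.classNumber K) := by
  have hirr := irreducible_cubic_d215832p
  have hd : |NumberField.discr K| ≤ (215832 : ℕ) :=
    (abs_discr_le_abs_cubic_discr K h3 b hirr hb).trans (by simp only [Cubic.discr]; norm_num)
  refine odd_classNumber_of_cubeCertificate K h3 (B := 132)
    (minkowskiBound_lt_of_sqrt_le K h3 hd (s := 464.58)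
      ((Real.sqrt_le_sqrt (by norm_num : ((215832 : ℕ) : ℝ) ≤ (464.58 : ℝ) ^ 2)).trans (Real.sqrt_sq (by norm_num)).le)
      (by norm_num)) ?_
  intro ℓ hℓB hℓ J hJ
  interval_cases ℓ <;> norm_num at hℓ
  · -- `ℓ = 2`: roots [0, 1]
    refine pow_three_eq_span_of_cert K h3 b hirr hb (by norm_num) (fun a ha hdvd => ?_) hJ
    interval_cases a <;> norm_num at hdvd
    · exact Or.inl ⟨(294585554849821990688), (1813079348934221334327), (-274817992828146661180), 1, by norm_num, by norm_num, ⟨_, by rw [Nat.cast_one, one_mul]⟩, by norm_num⟩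
    · exact Or.inl ⟨(-48895), (-300933), (45614), 1, by norm_num, by norm_num, ⟨_, by rw [Nat.cast_one, one_mul]⟩, by norm_num⟩
  · -- `ℓ = 3`: roots [0, 2]
    refine pow_three_eq_span_of_cert K h3 b hirr hb (by norm_num) (fun a ha hdvd => ?_) hJ
    interval_cases a <;> norm_num at hdvd
    · exact Or.inl ⟨(-291), (-38), (12), 1, by norm_num, by norm_num, ⟨_, by rw [Nat.cast_one, one_mul]⟩, by norm_num⟩
    · exact Or.inl ⟨(-1), (-9), (-17), 1, by norm_num, by norm_num, ⟨_, by rw [Nat.cast_one, one_mul]⟩, by norm_num⟩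
  · -- `ℓ = 5`: roots [4]
    refine pow_three_eq_span_of_cert K h3 b hirr hb (by norm_num) (fun a ha hdvd => ?_) hJ
    interval_cases a <;> norm_num at hdvd
    · exact Or.inl ⟨(-37), (-1), (1), 1, by norm_num, by norm_num, ⟨_, by rw [Nat.cast_one, one_mul]⟩, by norm_num⟩
  · -- `ℓ = 7`: roots []
    refine pow_three_eq_span_of_cert K h3 b hirr hb (by norm_num) (fun a ha hdvd => ?_) hJ
    interval_cases a <;> norm_num at hdvd
  · -- `ℓ = 11`: roots [1, 4, 7]
    refine pow_three_eq_span_of_cert K h3 b hirr hb (by norm_num) (fun a ha hdvd => ?_) hJ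
    interval_cases a <;> norm_num at hdvd
    · exact Or.inl ⟨(414791894294927), (12706427020070), (-10969090883914), 1, by norm_num, by norm_num, ⟨_, by rw [Nat.cast_one, one_mul]⟩, by norm_num⟩
    · exact Or.inl ⟨(-7), (-46), (-8), 1, by norm_num, by norm_num, ⟨_, by rw [Nat.cast_one, one_mul]⟩, by norm_num⟩
    · exact Or.inl ⟨(-1), (-6), (2), 1, by norm_num, by norm_num, ⟨_, by rw [Nat.cast_one, one_mul]⟩, by norm_num⟩
  · -- `ℓ = 13`: roots [2]
    refine pow_three_eq_span_of_cert K h3 b hirr hb (by norm_num) (fun a ha hdvd => ?_) hJ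
    interval_cases a <;> norm_num at hdvd
    · exact Or.inl ⟨(-7), (-43), (7), 1, by norm_num, by norm_num, ⟨_, by rw [Nat.cast_one, one_mul]⟩, by norm_num⟩
  · -- `ℓ = 17`: roots [3, 12]
    refine pow_three_eq_span_of_cert K h3 b hirr hb (by norm_num) (fun a ha hdvd => ?_) hJ
    interval_cases a <;> norm_num at hdvd
    · exact Or.inl ⟨(12249856403588449), (375099502159267), (-323972492260723), 1, by norm_num, by norm_num, ⟨_, by rw [Nat.cast_one, one_mul]⟩, by norm_num⟩
    · exact Or.inl ⟨(632487935), (19379013), (-16725333), 1, by norm_num, by norm_num, ⟨_, by rw [Nat.cast_one, one_mul]⟩, by norm_num⟩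
  · -- `ℓ = 19`: roots []
    refine pow_three_eq_span_of_cert K h3 b hirr hb (by norm_num) (fun a ha hdvd => ?_) hJ
    interval_cases a <;> norm_num at hdvd
  · -- `ℓ = 23`: roots [8]
    refine pow_three_eq_span_of_cert K h3 b hirr hb (by norm_num) (fun a ha hdvd => ?_) hJ
    interval_cases a <;> norm_num at hdvd
    · exact Or.inl ⟨(74929680914780526719), (485645382739225928851), (84371372821425808063), 1, by norm_num, by norm_num, ⟨_, by rw [Nat.cast_one, one_mul]⟩, by norm_num⟩
  · -- `ℓ = 29`: roots [27]
    refine pow_three_eq_span_of_cert K h3 b hirr hb (by norm_num) (fun a ha hdvd => ?_) hJ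
    interval_cases a <;> norm_num at hdvd
    · exact Or.inl ⟨(-41), (-276), (-48), 1, by norm_num, by norm_num, ⟨_, by rw [Nat.cast_one, one_mul]⟩, by norm_num⟩
  · -- `ℓ = 31`: roots []
    refine pow_three_eq_span_of_cert K h3 b hirr hb (by norm_num) (fun a ha hdvd => ?_) hJ
    interval_cases a <;> norm_num at hdvd
  · -- `ℓ = 37`: roots []
    refine pow_three_eq_span_of_cert K h3 b hirr hb (by norm_num) (fun a ha hdvd => ?_) hJ
    interval_cases a <;> norm_num at hdvd
  · -- `ℓ = 41`: roots []
    refine pow_three_eq_span_of_cert K h3 b hirr hb (by norm_num) (fun a ha hdvd => ?_) hJ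
    interval_cases a <;> norm_num at hdvd
  · -- `ℓ = 43`: roots []
    refine pow_three_eq_span_of_cert K h3 b hirr hb (by norm_num) (fun a ha hdvd => ?_) hJ
    interval_cases a <;> norm_num at hdvd
  · -- `ℓ = 47`: roots []
    refine pow_three_eq_span_of_cert K h3 b hirr hb (by norm_num) (fun a ha hdvd => ?_) hJ
    interval_cases a <;> norm_num at hdvd
  · -- `ℓ = 53`: roots []
    refine pow_three_eq_span_of_cert K h3 b hirr hb (by norm_num) (fun a ha hdvd => ?_) hJ
    interval_cases a <;> norm_num at hdvd
  · -- `ℓ = 59`: roots [22]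
    refine pow_three_eq_span_of_cert K h3 b hirr hb (by norm_num) (fun a ha hdvd => ?_) hJ
    interval_cases a <;> norm_num at hdvd
    · exact Or.inl ⟨(-7), (-26), (4), 1, by norm_num, by norm_num, ⟨_, by rw [Nat.cast_one, one_mul]⟩, by norm_num⟩
  · -- `ℓ = 61`: roots []
    refine pow_three_eq_span_of_cert K h3 b hirr hb (by norm_num) (fun a ha hdvd => ?_) hJ
    interval_cases a <;> norm_num at hdvd
  · -- `ℓ = 67`: roots [14, 20, 34]
    refine pow_three_eq_span_of_cert K h3 b hirr hb (by norm_num) (fun a ha hdvd => ?_) hJ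
    interval_cases a <;> norm_num at hdvd
    · exact Or.inl ⟨(-44849), (-1374), (1186), 1, by norm_num, by norm_num, ⟨_, by rw [Nat.cast_one, one_mul]⟩, by norm_num⟩
    · exact Or.inl ⟨(-1), (-17), (-3), 1, by norm_num, by norm_num, ⟨_, by rw [Nat.cast_one, one_mul]⟩, by norm_num⟩
    · exact Or.inl ⟨(-3153639136934468117), (-96625422324507360), (83393946048064528), 1, by norm_num, by norm_num, ⟨_, by rw [Nat.cast_one, one_mul]⟩, by norm_num⟩
  · -- `ℓ = 71`: roots [57]
    refine pow_three_eq_span_of_cert K h3 b hirr hb (by norm_num) (fun a ha hdvd => ?_) hJ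
    interval_cases a <;> norm_num at hdvd
    · exact Or.inl ⟨(-638004452602321), (-19548035460246), (16871210239502), 1, by norm_num, by norm_num, ⟨_, by rw [Nat.cast_one, one_mul]⟩, by norm_num⟩
  · -- `ℓ = 73`: roots [18]
    refine pow_three_eq_span_of_cert K h3 b hirr hb (by norm_num) (fun a ha hdvd => ?_) hJ
    interval_cases a <;> norm_num at hdvd
    · exact Or.inl ⟨(-334708739747), (-2169378215747), (-376887042851), 1, by norm_num, by norm_num, ⟨_, by rw [Nat.cast_one, one_mul]⟩, by norm_num⟩
  · -- `ℓ = 79`: roots [22, 67, 70]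
    refine pow_three_eq_span_of_cert K h3 b hirr hb (by norm_num) (fun a ha hdvd => ?_) hJ
    interval_cases a <;> norm_num at hdvd
    · exact Or.inl ⟨(-913), (-5962), (-1036), 1, by norm_num, by norm_num, ⟨_, by rw [Nat.cast_one, one_mul]⟩, by norm_num⟩
    · exact Or.inl ⟨(-553), (-33), (17), 1, by norm_num, by norm_num, ⟨_, by rw [Nat.cast_one, one_mul]⟩, by norm_num⟩
    · exact Or.inl ⟨(71583676197399846265), (2193276606415420460), (-1892938593009394846), 1, by norm_num, by norm_num, ⟨_, by rw [Nat.cast_one, one_mul]⟩, by norm_num⟩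
  · -- `ℓ = 83`: roots [65]
    refine pow_three_eq_span_of_cert K h3 b hirr hb (by norm_num) (fun a ha hdvd => ?_) hJ
    interval_cases a <;> norm_num at hdvd
    · exact Or.inl ⟨(-1165), (-37), (31), 1, by norm_num, by norm_num, ⟨_, by rw [Nat.cast_one, one_mul]⟩, by norm_num⟩
  · -- `ℓ = 89`: roots [56]
    refine pow_three_eq_span_of_cert K h3 b hirr hb (by norm_num) (fun a ha hdvd => ?_) hJ
    interval_cases a <;> norm_num at hdvd
    · exact Or.inl ⟨(-85), (-4), (2), 1, by norm_num, by norm_num, ⟨_, by rw [Nat.cast_one, one_mul]⟩, by norm_num⟩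
  · -- `ℓ = 97`: roots [58]
    refine pow_three_eq_span_of_cert K h3 b hirr hb (by norm_num) (fun a ha hdvd => ?_) hJ
    interval_cases a <;> norm_num at hdvd
    · exact Or.inl ⟨(-3196523381228108758814159), (-19673573382933230697020104), (2982027208038711940306296), 1, by norm_num, by norm_num, ⟨_, by rw [Nat.cast_one, one_mul]⟩, by norm_num⟩
  · -- `ℓ = 101`: roots [50, 74, 79]
    refine pow_three_eq_span_of_cert K h3 b hirr hb (by norm_num) (fun a ha hdvd => ?_) hJ
    interval_cases a <;> norm_num at hdvd
    · exact Or.inl ⟨(-1), (-2), (0), 1, by norm_num, by norm_num, ⟨_, by rw [Nat.cast_one, one_mul]⟩, by norm_num⟩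
    · exact Or.inl ⟨(-19), (-9), (-1), 1, by norm_num, by norm_num, ⟨_, by rw [Nat.cast_one, one_mul]⟩, by norm_num⟩
    · exact Or.inl ⟨(5), (-21), (3), 1, by norm_num, by norm_num, ⟨_, by rw [Nat.cast_one, one_mul]⟩, by norm_num⟩
  · -- `ℓ = 103`: roots [27]
    refine pow_three_eq_span_of_cert K h3 b hirr hb (by norm_num) (fun a ha hdvd => ?_) hJ
    interval_cases a <;> norm_num at hdvd
    · exact Or.inl ⟨(-126283), (-777231), (117809), 1, by norm_num, by norm_num, ⟨_, by rw [Nat.cast_one, one_mul]⟩, by norm_num⟩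
  · -- `ℓ = 107`: roots []
    refine pow_three_eq_span_of_cert K h3 b hirr hb (by norm_num) (fun a ha hdvd => ?_) hJ
    interval_cases a <;> norm_num at hdvd
  · -- `ℓ = 109`: roots []
    refine pow_three_eq_span_of_cert K h3 b hirr hb (by norm_num) (fun a ha hdvd => ?_) hJ
    interval_cases a <;> norm_num at hdvd
  · -- `ℓ = 113`: roots []
    refine pow_three_eq_span_of_cert K h3 b hirr hb (by norm_num) (fun a ha hdvd => ?_) hJ
    interval_cases a <;> norm_num at hdvd
  · -- `ℓ = 127`: roots [47]
    refine pow_three_eq_span_of_cert K h3 b hirr hb (by norm_num) (fun a ha hdvd => ?_) hJ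
    interval_cases a <;> norm_num at hdvd
    · exact Or.inl ⟨(1407211433570319835316771254802131907), (43116029818350043285628515504801765), (-37211903224987228903141484779345761), 1, by norm_num, by norm_num, ⟨_, by rw [Nat.cast_one, one_mul]⟩, by norm_num⟩
  · -- `ℓ = 131`: roots [11, 47, 74]
    refine pow_three_eq_span_of_cert K h3 b hirr hb (by norm_num) (fun a ha hdvd => ?_) hJ
    interval_cases a <;> norm_num at hdvd
    · exact Or.inl ⟨(-491), (-15), (13), 1, by norm_num, by norm_num, ⟨_, by rw [Nat.cast_one, one_mul]⟩, by norm_num⟩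
    · exact Or.inl ⟨(742355429), (4811464569), (835897727), 1, by norm_num, by norm_num, ⟨_, by rw [Nat.cast_one, one_mul]⟩, by norm_num⟩
    · exact Or.inl ⟨(-13349), (-409), (353), 1, by norm_num, by norm_num, ⟨_, by rw [Nat.cast_one, one_mul]⟩, by norm_num⟩

end Certd215832p

end Summit.BirchSwinnertonDyer.BirchSwinnertonDyer.Theorems.AddKatoTwo

end
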